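import Summits.CriticalPhenomena.CardyFormulaZ2.Theorems.CardyIKTransportCornerLineDescentLine
import Summits.CriticalPhenomena.CardyFormulaZ2.Theorems.CardyIKTransportCornerLineDescentSyndromeBiasCharacters

/-!
# Syndrome bias, part 4/5: the block gauge of the corner-line model

Support file for `stub_SyndromeBias` (stmt-CriticalPhenomena-10964): the gauge colour in `ZMod 2`, the GF(2) identity
`parity(Rect(0,v)) = c + α(v0) + β(v1) + Π_Λ(v)` (`boxZ_split`), the SHEAR `(A, B) ↦ (A ∆ T_A(D), B ∆ T_B(D))` to the
block colours `[v0 ∈ A] + [v1 ∈ B] + Π_Λ(v)` (`colour_shear`), the finite bit windows read by the ring cylinder with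
the determinedness lemmas, and the shear of the cylinder expansion (`tripleSum_shear`).
-/

noncomputable section

namespace Summit.CriticalPhenomena.CardyFormulaZ2.Theorems.CornerLineDescent.SymmetricSeed

open scoped BigOperators Classical MeasureTheory ProbabilityTheory
open MeasureTheory
open Literature.Probability.Percolation (sitePercolation half)
open Literature.Probability.LatticeModels
open Finset

/-- ANCHOR OF PART 4 (proposed registered sub-goal; vocabulary-only signature). The ring `faceRing f r` lies in the
window `|v0| ≤ |f0| + r + 1`, `|v1| ≤ |f1| + r + 1` (so its colours read finitely many bits). [folklore] -/
theorem abs_le_of_mem_faceRing : ∀ (f : Site 2) (r : ℕ) (v : Site 2), v ∈ faceRing f r → |v 0| ≤ |f 0| + r + 1 ∧ |v 1| ≤ |f 1| + r + 1 := by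
  intro f r v hv
  obtain ⟨⟨h1, h2, h3, h4⟩, -⟩ := hv
  have := le_abs_self (f 0); have := neg_abs_le (f 0)
  have := le_abs_self (f 1); have := neg_abs_le (f 1)
  have : (0 : ℤ) ≤ r := by positivity
  constructor <;> rw [abs_le] <;> constructor <;> linarith

namespace SyndromeBias

/-- The clamped syndrome density `projIcc 0 1 p` as a real number (equal to `p` on `[0,1]`). [folklore] -/
def qOf (p : ℝ) : ℝ := (Set.projIcc (0:ℝ) 1 zero_le_one p : ℝ)

/-- The cylinder expansion of a gauge event read on the column bits `KA`, the row bits `KB` and the syndromes `KD`: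
the sum over bit patterns of the product Bernoulli weights (`½` per column/row bit, `q^{#S}(1-q)^{#KD-#S}` for the
syndromes). [folklore] -/
def tripleSum (p : ℝ) (KA KB : Finset ℤ) (KD : Finset (Site 2)) (E : Set Bits) : ℝ :=
  ∑ SA ∈ KA.powerset, ∑ SB ∈ KB.powerset, ∑ SD ∈ KD.powerset,
    if (((↑SA : Set ℤ), ((↑SB : Set ℤ), ((↑SD : Set (Site 2)),
        ((∅ : Set (Site 2)), (∅ : Set (Site 2)))))) : Bits) ∈ E
    then ((1 / 2 : ℝ) ^ KA.card * (1 / 2 : ℝ) ^ KB.card) *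
      (qOf p ^ SD.card * (1 - qOf p) ^ (KD.card - SD.card)) else 0

/-- `DetBy KA KB KD`: the events determined by the column bits in `KA`, the row bits in `KB` and the syndromes in
`KD` (reading neither auxiliary fair field). [folklore] -/
def DetBy (KA KB : Finset ℤ) (KD : Finset (Site 2)) : Set (Set Bits) :=
  {E | ∀ ω ω' : Bits, ω.1 ∩ ↑KA = ω'.1 ∩ ↑KA → ω.2.1 ∩ ↑KB = ω'.2.1 ∩ ↑KB →
    ω.2.2.1 ∩ ↑KD = ω'.2.2.1 ∩ ↑KD → (ω ∈ E ↔ ω' ∈ E)}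

/-- The site `![x, y] : Site 2` of the integer pair `(x, y)`, as Mathlib's equivalence `(finTwoArrowEquiv ℤ).symm`
(so that its injectivity is `toSite.injective`). [folklore] -/
def toSite : ℤ × ℤ ≃ Site 2 := (finTwoArrowEquiv ℤ).symm

/-- `![f 0, f 1] = f`. [folklore] -/
theorem toSite_pair (f : Site 2) : toSite (f 0, f 1) = f := (finTwoArrowEquiv ℤ).symm_apply_apply f

/-- The indicator of a proposition in `ZMod 2` (classical `if`, no instance argument, so that rewriting inside it is
syntactic). [folklore] -/
def bz (P : Prop) : ZMod 2 := if P then 1 else 0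

/-- The integer interval between `0` and `x` (`[0,x)` or `[x,0)`), the side of the gauge rectangle `Rect(0,v)`.
[folklore] -/
def I0 (x : ℤ) : Finset ℤ := Finset.Ico (min 0 x) (max 0 x)

/-- Parity (in `ZMod 2`) of the syndromes of `D` in the box `A × B`. [folklore] -/
def boxZ (D : Set (Site 2)) (A B : Finset ℤ) : ZMod 2 :=
  ∑ i ∈ A, ∑ j ∈ B, bz (toSite (i, j) ∈ D)

/-- `Xor P (z = 1)` is the `ZMod 2` equation `[P] + z = 1`. [folklore] -/
theorem xor_iff_bz (P : Prop) (z : ZMod 2) : Xor P (z = 1) ↔ bz P + z = 1 := by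
  unfold bz
  by_cases hP : P
  · simp only [hP, if_true, Xor, true_and, not_true, and_false, or_false]
    revert z; decide
  · simp only [hP, if_false, Xor, false_and, not_false_iff, and_true, false_or, zero_add]

/-- The gauge colour in `ZMod 2`: `colour(v) = [v0 ∈ A] + [v1 ∈ B] + parity(D ∩ Rect(0,v))`. [folklore] -/
theorem gaugeColour_iff_boxZ (ω : Bits) (v : Site 2) :
    gaugeColour ω v ↔
      bz (v 0 ∈ ω.1) + bz (v 1 ∈ ω.2.1) + boxZ ω.2.2.1 (I0 (v 0)) (I0 (v 1)) = 1 := by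
  have hcard : (((I0 (v 0) ×ˢ I0 (v 1)).filter (fun s : ℤ × ℤ => toSite s ∈ ω.2.2.1)).card : ZMod 2) =
      boxZ ω.2.2.1 (I0 (v 0)) (I0 (v 1)) := by
    unfold boxZ bz
    rw [← Finset.sum_product (s := I0 (v 0)) (t := I0 (v 1))
      (f := fun c : ℤ × ℤ => if toSite (c.1, c.2) ∈ ω.2.2.1 then (1 : ZMod 2) else 0)]
    simp only [Prod.mk.eta, Finset.sum_boole]
  have hpar : ∀ s : ℤ × ℤ, ((![s.1, s.2] : Site 2) 0 ∈ (Set.univ : Set ℤ) ∧ (![s.1, s.2] : Site 2) ∈ ω.2.2.1 ∨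
      (![s.1, s.2] : Site 2) 0 ∉ (Set.univ : Set ℤ) ∧ (![s.1, s.2] : Site 2) ∈ ω.2.2.2.1) ↔
      toSite s ∈ ω.2.2.1 := by
    intro s; simp [toSite]
  unfold gaugeColour
  simp only []
  rw [Finset.filter_congr (fun s _ => hpar s), show Finset.Ico (min 0 (v 0)) (max 0 (v 0)) = I0 (v 0)
    from rfl, show Finset.Ico (min 0 (v 1)) (max 0 (v 1)) = I0 (v 1) from rfl,
    ← ZMod.natCast_eq_one_iff_odd, hcard, xor_iff_bz, xor_iff_bz, add_assoc]

/-- The GF(2) interval identity `1_{I(x)} = 1_{I(a)} + 1_{[a,x)}` for `a ≤ x` (three sign cases), summed against any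
`ZMod 2`-valued function. [folklore] -/
theorem sum_I0_split {a x : ℤ} (hax : a ≤ x) (g : ℤ → ZMod 2) :
    ∑ s ∈ I0 x, g s = ∑ s ∈ I0 a, g s + ∑ s ∈ Finset.Ico a x, g s := by
  unfold I0
  rcases le_or_gt 0 a with ha | ha
  · have hx : 0 ≤ x := ha.trans hax
    rw [min_eq_left ha, max_eq_right ha, min_eq_left hx, max_eq_right hx,
      ← Finset.sum_union (Finset.Ico_disjoint_Ico_consecutive 0 a x),
      Finset.Ico_union_Ico_eq_Ico ha hax]
  · rw [min_eq_right ha.le, max_eq_left ha.le]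
    rcases le_or_gt 0 x with hx | hx
    · rw [min_eq_left hx, max_eq_right hx, ← Finset.Ico_union_Ico_eq_Ico ha.le hx,
        Finset.sum_union (Finset.Ico_disjoint_Ico_consecutive a 0 x), ← add_assoc,
        CharTwo.add_self_eq_zero, zero_add]
    · rw [min_eq_right hx.le, max_eq_left hx.le, ← Finset.Ico_union_Ico_eq_Ico hax hx.le,
        Finset.sum_union (Finset.Ico_disjoint_Ico_consecutive a x 0),
        add_comm (∑ s ∈ Finset.Ico a x, g s) _, add_assoc, CharTwo.add_self_eq_zero, add_zero]

/-- The GF(2) rectangle identity: for a cell `v` north-east of the corner `(a,b)`, `parity(Rect(0,v)) = c + α(v0) +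
β(v1) + Π_Λ(v)` with `c = parity(I(a)×I(b))`, `α(x) = parity([a,x)×I(b))`, `β(y) = parity(I(a)×[b,y))` and the BLOCK
parity `Π_Λ(v) = parity([a,v0)×[b,v1))`. [folklore] -/
theorem boxZ_split (D : Set (Site 2)) {a b : ℤ} {v : Site 2} (ha : a ≤ v 0) (hb : b ≤ v 1) :
    boxZ D (I0 (v 0)) (I0 (v 1)) =
      boxZ D (I0 a) (I0 b) + boxZ D (Finset.Ico a (v 0)) (I0 b) +
        boxZ D (I0 a) (Finset.Ico b (v 1)) + boxZ D (Finset.Ico a (v 0)) (Finset.Ico b (v 1)) := by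
  unfold boxZ
  rw [sum_I0_split ha]
  have h1 : ∀ i : ℤ, ∑ j ∈ I0 (v 1), bz (toSite (i, j) ∈ D) =
      ∑ j ∈ I0 b, bz (toSite (i, j) ∈ D) + ∑ j ∈ Finset.Ico b (v 1), bz (toSite (i, j) ∈ D) :=
    fun i => sum_I0_split hb _
  simp only [h1, Finset.sum_add_distrib]
  abel

/-- The shear of the column bits: `x ↦ c + α(x)` (a function of the syndromes). [folklore] -/
def TA (a b : ℤ) (D : Set (Site 2)) : Set ℤ :=
  {x | boxZ D (I0 a) (I0 b) + boxZ D (Finset.Ico a x) (I0 b) = 1}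

/-- The shear of the row bits: `y ↦ β(y)` (a function of the syndromes). [folklore] -/
def TB (a b : ℤ) (D : Set (Site 2)) : Set ℤ := {y | boxZ D (I0 a) (Finset.Ico b y) = 1}

/-- The BLOCK colour `[v0 ∈ A] + [v1 ∈ B] + Π_Λ(v)` of the corner-`(a,b)` gauge, reading only syndromes north-east
of `(a,b)`. [folklore] -/
def blockZ (a b : ℤ) (A B : Set ℤ) (D : Set (Site 2)) (v : Site 2) : ZMod 2 :=
  bz (v 0 ∈ A) + bz (v 1 ∈ B) + boxZ D (Finset.Ico a (v 0)) (Finset.Ico b (v 1))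

/-- `[x ∈ A ∆ T] = [x ∈ A] + [x ∈ T]` in `ZMod 2`. [folklore] -/
theorem bz_mem_symmDiff (x : ℤ) (A T : Set ℤ) :
    bz (x ∈ symmDiff A T) = bz (x ∈ A) + bz (x ∈ T) := by
  unfold bz
  rw [Set.mem_symmDiff]
  by_cases hA : x ∈ A <;> by_cases hT : x ∈ T
  · simp only [hA, hT, not_true, and_false, or_self, if_false, if_true]; decide
  · simp [hA, hT]
  · simp [hA, hT]
  · simp [hA, hT]

/-- `[z = 1] = z` for `z : ZMod 2`. [folklore] -/
theorem bz_eq_one (z : ZMod 2) : bz (z = 1) = z := by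
  unfold bz
  by_cases h : z = 1
  · rw [if_pos h, h]
  · rw [if_neg h]
    revert z; decide

/-- Equivalent propositions have the same indicator. [folklore] -/
theorem bz_congr {P Q : Prop} (h : P ↔ Q) : bz P = bz Q := congrArg bz (propext h)

/-- THE SHEAR IDENTITY: north-east of `(a,b)` the gauge colour of `(A, B, D)` is the block colour of `(A ∆ T_A(D), B
∆ T_B(D), D)`. [folklore] -/
theorem colour_shear (a b : ℤ) (ω : Bits) {v : Site 2} (ha : a ≤ v 0) (hb : b ≤ v 1) :
    gaugeColour ω v ↔
      blockZ a b (symmDiff ω.1 (TA a b ω.2.2.1)) (symmDiff ω.2.1 (TB a b ω.2.2.1)) ω.2.2.1 v = 1 := by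
  rw [gaugeColour_iff_boxZ, boxZ_split _ ha hb]
  unfold blockZ
  rw [bz_mem_symmDiff, bz_mem_symmDiff]
  have hA : bz (v 0 ∈ TA a b ω.2.2.1) =
      boxZ ω.2.2.1 (I0 a) (I0 b) + boxZ ω.2.2.1 (Finset.Ico a (v 0)) (I0 b) := by
    rw [show bz (v 0 ∈ TA a b ω.2.2.1) = bz (boxZ ω.2.2.1 (I0 a) (I0 b) +
      boxZ ω.2.2.1 (Finset.Ico a (v 0)) (I0 b) = 1) from bz_congr Iff.rfl, bz_eq_one]
  have hB : bz (v 1 ∈ TB a b ω.2.2.1) = boxZ ω.2.2.1 (I0 a) (Finset.Ico b (v 1)) := by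
    rw [show bz (v 1 ∈ TB a b ω.2.2.1) = bz (boxZ ω.2.2.1 (I0 a) (Finset.Ico b (v 1)) = 1)
      from bz_congr Iff.rfl, bz_eq_one]
  rw [hA, hB]
  have key : bz (v 0 ∈ ω.1) + bz (v 1 ∈ ω.2.1) +
      (boxZ ω.2.2.1 (I0 a) (I0 b) + boxZ ω.2.2.1 (Finset.Ico a (v 0)) (I0 b) +
        boxZ ω.2.2.1 (I0 a) (Finset.Ico b (v 1)) + boxZ ω.2.2.1 (Finset.Ico a (v 0)) (Finset.Ico b (v 1))) =
      bz (v 0 ∈ ω.1) + (boxZ ω.2.2.1 (I0 a) (I0 b) + boxZ ω.2.2.1 (Finset.Ico a (v 0)) (I0 b)) +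
        (bz (v 1 ∈ ω.2.1) + boxZ ω.2.2.1 (I0 a) (Finset.Ico b (v 1))) +
        boxZ ω.2.2.1 (Finset.Ico a (v 0)) (Finset.Ico b (v 1)) := by ring
  rw [key]

/-- Box parities agree for syndrome sets that agree on the box. [folklore] -/
theorem boxZ_congr {D D' : Set (Site 2)} {A B : Finset ℤ}
    (h : ∀ i ∈ A, ∀ j ∈ B, (toSite (i, j) ∈ D ↔ toSite (i, j) ∈ D')) : boxZ D A B = boxZ D' A B := by
  unfold boxZ
  exact Finset.sum_congr rfl fun i hi => Finset.sum_congr rfl fun j hj => bz_congr (h i hi j hj)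

/-- `DetBy` is closed under intersection. [folklore] -/
theorem DetBy.inter {KA KB : Finset ℤ} {KD : Finset (Site 2)} {E₁ E₂ : Set Bits}
    (h₁ : E₁ ∈ DetBy KA KB KD) (h₂ : E₂ ∈ DetBy KA KB KD) : E₁ ∩ E₂ ∈ DetBy KA KB KD :=
  fun ω ω' hA hB hD => and_congr (h₁ ω ω' hA hB hD) (h₂ ω ω' hA hB hD)

/-- On `K`, shearing twice by `T` (once as a finite pattern, once as a set) cancels. [folklore] -/
theorem mem_shear_cancel {K S : Finset ℤ} {T : Set ℤ} {x : ℤ} (hx : x ∈ K) :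
    x ∈ symmDiff (↑(symmDiff S (K.filter (· ∈ T))) : Set ℤ) T ↔ x ∈ (↑S : Set ℤ) := by
  simp only [Set.mem_symmDiff, Finset.mem_coe, Finset.mem_symmDiff, Finset.mem_filter]
  by_cases hS : x ∈ S <;> by_cases hT : x ∈ T <;> simp [hS, hT, hx]

/-- Symmetric difference with a fixed `T ⊆ K` is a bijection of the patterns on `K` (reindexing of a sum).
[folklore] -/
theorem sum_powerset_symmDiff (K T : Finset ℤ) (hT : T ⊆ K) (g : Finset ℤ → ℝ) :
    ∑ S ∈ K.powerset, g S = ∑ S ∈ K.powerset, g (symmDiff S T) := by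
  refine Finset.sum_nbij' (fun S => symmDiff S T) (fun S => symmDiff S T) ?_ ?_ ?_ ?_ ?_
  · intro S hS
    rw [Finset.mem_powerset] at hS ⊢
    exact symmDiff_le_sup.trans (sup_le hS hT)
  · intro S hS
    rw [Finset.mem_powerset] at hS ⊢
    exact symmDiff_le_sup.trans (sup_le hS hT)
  · intro S _; exact symmDiff_symmDiff_cancel_right T S
  · intro S _; exact symmDiff_symmDiff_cancel_right T S
  · intro S _; simp only [symmDiff_symmDiff_cancel_right]

/-- The column-bit window of the block of radius `r` around the face `f`: `[f0 - r, f0 + 1 + r]`. [folklore] -/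
def KAw (f : Site 2) (r : ℕ) : Finset ℤ := Finset.Icc (f 0 - r) (f 0 + 1 + r)

/-- The row-bit window `[f1 - r, f1 + 1 + r]`. [folklore] -/
def KBw (f : Site 2) (r : ℕ) : Finset ℤ := Finset.Icc (f 1 - r) (f 1 + 1 + r)

/-- A bound `|f0| + |f1| + r + 1` on all coordinates read by the ring colours. [folklore] -/
def Mb (f : Site 2) (r : ℕ) : ℤ := |f 0| + |f 1| + r + 1

/-- The syndrome window: all sites with both coordinates in `[-Mb, Mb]`. [folklore] -/
def KDw (f : Site 2) (r : ℕ) : Finset (Site 2) :=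
  (Finset.Icc (-Mb f r) (Mb f r) ×ˢ Finset.Icc (-Mb f r) (Mb f r)).image toSite

/-- The inner columns `[f0 - r, f0 + r]` (as `Ico (f0 - r) (f0 + 1 + r)`), `2r + 1` of them. [folklore] -/
def Rc (f : Site 2) (r : ℕ) : Finset ℤ := Finset.Ico (f 0 - r) (f 0 + 1 + r)

/-- The inner rows `[f1 - r, f1 + r]`. [folklore] -/
def Cr (f : Site 2) (r : ℕ) : Finset ℤ := Finset.Ico (f 1 - r) (f 1 + 1 + r)

/-- The `(2r+1)²` inner syndromes of the block (the only syndromes the block colours of the ring read). [folklore]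
-/
def InD (f : Site 2) (r : ℕ) : Finset (Site 2) := (Rc f r ×ˢ Cr f r).image toSite

/-- The ring cylinder of the BLOCK gauge: the block colours on `faceRing f r` are prescribed by `η`. [folklore] -/
def blockEvent (f : Site 2) (r : ℕ) (η : Site 2 → Prop) : Set Bits :=
  {ω | ∀ v ∈ faceRing f r, (blockZ (f 0 - r) (f 1 - r) ω.1 ω.2.1 ω.2.2.1 v = 1 ↔ η v)}

/-- `0 ≤ Mb`. [folklore] -/
theorem Mb_nonneg (f : Site 2) (r : ℕ) : 0 ≤ Mb f r := by
  unfold Mb; positivity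

/-- The block lies inside the syndrome window. [folklore] -/
theorem corner_bounds (f : Site 2) (r : ℕ) :
    -Mb f r ≤ f 0 - r ∧ f 0 + 1 + r ≤ Mb f r ∧ -Mb f r ≤ f 1 - r ∧ f 1 + 1 + r ≤ Mb f r := by
  unfold Mb
  have := le_abs_self (f 0); have := neg_abs_le (f 0)
  have := le_abs_self (f 1); have := neg_abs_le (f 1)
  have : (0 : ℤ) ≤ r := by positivity
  refine ⟨?_, ?_, ?_, ?_⟩ <;> linarith

/-- Sites with window-bounded coordinates lie in the syndrome window. [folklore] -/
theorem toSite_mem_KDw {f : Site 2} {r : ℕ} {i j : ℤ} (hi : -Mb f r ≤ i ∧ i ≤ Mb f r)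
    (hj : -Mb f r ≤ j ∧ j ≤ Mb f r) : toSite (i, j) ∈ (↑(KDw f r) : Set (Site 2)) := by
  rw [Finset.mem_coe]
  unfold KDw
  exact Finset.mem_image_of_mem _ (Finset.mem_product.2 ⟨Finset.mem_Icc.2 hi, Finset.mem_Icc.2 hj⟩)

/-- Ring cells have window-bounded coordinates. [folklore] -/
theorem bounds_of_mem_faceRing {f : Site 2} {r : ℕ} {v : Site 2} (hv : v ∈ faceRing f r) :
    (-Mb f r ≤ v 0 ∧ v 0 ≤ Mb f r) ∧ (-Mb f r ≤ v 1 ∧ v 1 ≤ Mb f r) := by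
  obtain ⟨⟨h1, h2, h3, h4⟩, -⟩ := hv
  unfold Mb
  have := le_abs_self (f 0); have := neg_abs_le (f 0)
  have := le_abs_self (f 1); have := neg_abs_le (f 1)
  have : (0 : ℤ) ≤ r := by positivity
  refine ⟨⟨?_, ?_⟩, ?_, ?_⟩ <;> linarith

/-- `I(x) ⊆ [-M, M]` when `|x| ≤ M`. [folklore] -/
theorem I0_bounds {M x i : ℤ} (hx : -M ≤ x ∧ x ≤ M) (hM : 0 ≤ M) (hi : i ∈ I0 x) : -M ≤ i ∧ i ≤ M := by
  unfold I0 at hi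
  rw [Finset.mem_Ico, min_le_iff, lt_max_iff] at hi
  omega

/-- The ring cylinder is determined by the three windows. [folklore] -/
theorem detBy_ringCylinder (f : Site 2) (r : ℕ) (η : Site 2 → Prop) :
    ringCylinder f r η ∈ DetBy (KAw f r) (KBw f r) (KDw f r) := by
  intro ω ω' hA hB hD
  simp only [ringCylinder, Set.mem_setOf_eq]
  refine forall₂_congr fun v hv => ?_
  obtain ⟨hv0, hv1⟩ := bounds_of_mem_faceRing hv
  obtain ⟨⟨h1, h2, h3, h4⟩, -⟩ := hv
  have hM := Mb_nonneg f r
  rw [gaugeColour_iff_boxZ, gaugeColour_iff_boxZ,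
    bz_congr (mem_iff_of_inter_eq hA (x := v 0) (by simp only [KAw, Finset.coe_Icc, Set.mem_Icc]; omega)),
    bz_congr (mem_iff_of_inter_eq hB (x := v 1) (by simp only [KBw, Finset.coe_Icc, Set.mem_Icc]; omega)),
    boxZ_congr (D := ω.2.2.1) (D' := ω'.2.2.1) (fun i hi j hj =>
      mem_iff_of_inter_eq hD (toSite_mem_KDw (I0_bounds hv0 hM hi) (I0_bounds hv1 hM hj)))]

/-- The block ring cylinder is determined by the three windows. [folklore] -/
theorem detBy_blockEvent (f : Site 2) (r : ℕ) (η : Site 2 → Prop) :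
    blockEvent f r η ∈ DetBy (KAw f r) (KBw f r) (KDw f r) := by
  intro ω ω' hA hB hD
  simp only [blockEvent, Set.mem_setOf_eq]
  refine forall₂_congr fun v hv => ?_
  obtain ⟨hv0, hv1⟩ := bounds_of_mem_faceRing hv
  obtain ⟨⟨h1, h2, h3, h4⟩, -⟩ := hv
  have hM := Mb_nonneg f r
  obtain ⟨c1, c2, c3, c4⟩ := corner_bounds f r
  unfold blockZ
  rw [bz_congr (mem_iff_of_inter_eq hA (x := v 0) (by simp only [KAw, Finset.coe_Icc, Set.mem_Icc]; omega)),
    bz_congr (mem_iff_of_inter_eq hB (x := v 1) (by simp only [KBw, Finset.coe_Icc, Set.mem_Icc]; omega)),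
    boxZ_congr (D := ω.2.2.1) (D' := ω'.2.2.1) (fun i hi j hj =>
      mem_iff_of_inter_eq hD (toSite_mem_KDw ?_ ?_))]
  · rw [Finset.mem_Ico] at hi; omega
  · rw [Finset.mem_Ico] at hj; omega

/-- The block ring cylinder reads only the INNER syndromes. [folklore] -/
theorem detBy_blockEvent' (f : Site 2) (r : ℕ) (η : Site 2 → Prop) :
    blockEvent f r η ∈ DetBy (KAw f r) (KBw f r) (InD f r) := by
  intro ω ω' hA hB hD
  simp only [blockEvent, Set.mem_setOf_eq]
  refine forall₂_congr fun v hv => ?_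
  obtain ⟨⟨h1, h2, h3, h4⟩, -⟩ := hv
  unfold blockZ
  rw [bz_congr (mem_iff_of_inter_eq hA (x := v 0) (by simp only [KAw, Finset.coe_Icc, Set.mem_Icc]; omega)),
    bz_congr (mem_iff_of_inter_eq hB (x := v 1) (by simp only [KBw, Finset.coe_Icc, Set.mem_Icc]; omega)),
    boxZ_congr (D := ω.2.2.1) (D' := ω'.2.2.1) (fun i hi j hj =>
      mem_iff_of_inter_eq hD ?_)]
  rw [Finset.mem_Ico] at hi hj
  rw [Finset.mem_coe]
  unfold InD Rc Cr
  exact Finset.mem_image_of_mem _ (Finset.mem_product.2 ⟨Finset.mem_Ico.2 ⟨hi.1, by omega⟩,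
    Finset.mem_Ico.2 ⟨hj.1, by omega⟩⟩)

/-- The event `κ_f = 1` is determined by the syndrome window. [folklore] -/
theorem detBy_syndrome (f : Site 2) (r : ℕ) :
    {ω : Bits | f ∈ ω.2.2.1} ∈ DetBy (KAw f r) (KBw f r) (KDw f r) := by
  intro ω ω' _ _ hD
  simp only [Set.mem_setOf_eq]
  have hM := Mb_nonneg f r
  have := le_abs_self (f 0); have := neg_abs_le (f 0)
  have := le_abs_self (f 1); have := neg_abs_le (f 1)
  have h := mem_iff_of_inter_eq hD (toSite_mem_KDw (f := f) (r := r) (i := f 0) (j := f 1)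
    (by unfold Mb; constructor <;> linarith) (by unfold Mb; constructor <;> linarith))
  rwa [toSite_pair] at h

/-- The event `κ_f = 1` reads an inner syndrome. [folklore] -/
theorem detBy_syndrome' (f : Site 2) (r : ℕ) :
    {ω : Bits | f ∈ ω.2.2.1} ∈ DetBy (KAw f r) (KBw f r) (InD f r) := by
  intro ω ω' _ _ hD
  simp only [Set.mem_setOf_eq]
  have h := mem_iff_of_inter_eq hD (x := toSite (f 0, f 1)) (by
    rw [Finset.mem_coe]; unfold InD Rc Cr
    exact Finset.mem_image_of_mem _ (Finset.mem_product.2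
      ⟨Finset.mem_Ico.2 ⟨by omega, by omega⟩, Finset.mem_Ico.2 ⟨by omega, by omega⟩⟩))
  rwa [toSite_pair] at h

/-- THE SHEAR OF THE CYLINDER EXPANSION: pattern by pattern of the syndromes, the bijection `(S_A, S_B) ↦ (S_A ∆
T_A, S_B ∆ T_B)` of the (uniformly weighted) column/row patterns carries the ring cylinder to the block ring
cylinder; events of the syndromes alone ride along. [folklore] -/
theorem tripleSum_shear (p : ℝ) (f : Site 2) (r : ℕ) (η : Site 2 → Prop) (P : Set (Site 2) → Prop) :
    tripleSum p (KAw f r) (KBw f r) (KDw f r) ({ω : Bits | P ω.2.2.1} ∩ ringCylinder f r η) =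
      tripleSum p (KAw f r) (KBw f r) (KDw f r) ({ω : Bits | P ω.2.2.1} ∩ blockEvent f r η) := by
  unfold tripleSum
  rw [Finset.sum_congr rfl fun SA _ => Finset.sum_comm, Finset.sum_comm]
  conv_rhs => rw [Finset.sum_congr rfl fun SA _ => Finset.sum_comm, Finset.sum_comm]
  refine Finset.sum_congr rfl fun SD _ => ?_
  set tA := (KAw f r).filter (· ∈ TA (f 0 - r) (f 1 - r) (↑SD : Set (Site 2))) with htA
  set tB := (KBw f r).filter (· ∈ TB (f 0 - r) (f 1 - r) (↑SD : Set (Site 2))) with htB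
  rw [sum_powerset_symmDiff (KAw f r) tA (Finset.filter_subset _ _)]
  refine Finset.sum_congr rfl fun SA hSA => ?_
  rw [sum_powerset_symmDiff (KBw f r) tB (Finset.filter_subset _ _)]
  refine Finset.sum_congr rfl fun SB hSB => ?_
  refine ite_congr_prop ?_
  simp only [Set.mem_inter_iff, Set.mem_setOf_eq, ringCylinder, blockEvent]
  refine and_congr Iff.rfl (forall₂_congr fun v hv => ?_)
  obtain ⟨⟨h1, h2, h3, h4⟩, -⟩ := hv
  rw [colour_shear (f 0 - r) (f 1 - r) _ h1 h3]
  unfold blockZ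
  rw [bz_congr (mem_shear_cancel (K := KAw f r) (S := SA) (T := TA (f 0 - r) (f 1 - r) (↑SD : Set (Site 2)))
      (x := v 0) (by simp only [KAw, Finset.mem_Icc]; omega)),
    bz_congr (mem_shear_cancel (K := KBw f r) (S := SB) (T := TB (f 0 - r) (f 1 - r) (↑SD : Set (Site 2)))
      (x := v 1) (by simp only [KBw, Finset.mem_Icc]; omega))]

end SyndromeBias

end Summit.CriticalPhenomena.CardyFormulaZ2.Theorems.CornerLineDescent.SymmetricSeed
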